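import Literature.AlgebraicGeometry.AbelianVarieties.MarkmanKernelTranslate
import HarnessLib

/-!
# Markman's twisted transform `Φ̃ = Φ ∘ ([Θ ⊠ Θ] ⊗)` as ONE span transform `Φ^{pr₁₂, g′}_𝒩`

Layer `Literature/AlgebraicGeometry/AbelianVarieties`; sequel to `MarkmanKernelSpan` (`Φ ≅ Φ^{pr₁₂, g′}_{𝒩₁}`) and
`MarkmanKernelTranslate` (the twisted kernel `𝒩 = 𝒩₁ ⊗ a^*𝒪(Θ) ⊗ b^*𝒪(Θ)`).
* §0 (generic, `Modules`) a source twist by a vector bundle is absorbed into the kernel of an integral transform: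
  `(L ⊗ –) ⋙ (K ⊗ p^*(–)) ≅ ((K ⊗ p^*L) ⊗ p^*(–))` and `D⁺(L ⊗ –) ⋙ Φ^{p,q}_K ≅ Φ^{p,q}_{K′}` for `K ⊗ p^*L ≅ K′`
  (`tensorLeftCompIntegralKernelFunctorIso`, `integralTransformPlusTwistIso`);
* §1 `Θ ⊠ Θ := p₁^*𝒪(Θ) ⊗ p₂^*𝒪(Θ)` on `A × A` (`thetaBox`, rank one, `pr₁₂^*[Θ ⊠ Θ] = a^*[Θ]·b^*[Θ]`), `𝒩₁ ⊗ pr₁₂^*(Θ ⊠ Θ) ≅ 𝒩`,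
  **`markmanPhiTildePlus A hΘ hK := Φ^{pr₁₂, g′}_𝒩`** and the bridge **`D⁺([Θ ⊠ Θ] ⊗ –) ⋙ markmanPhiPlus ≅ markmanPhiTildePlus`**
  (`markmanPhiTildePlusIso`, objectwise `nonempty_markmanPhiPlus_thetaBox_iso`) — print's «`Φ̃ := Φ ∘ ([Θ ⊠ Θ] ⊗)`».

Everything PROVED; 0 named facts; no instance, no notation; exactness instances in statements are binders. Typed for the cell
`pub-hodge-ring2` (crux 26512, plates (I)/(K1′)); a research route conditional on HC_CM, not a corollary — nothing here refers to it.

## References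

* E. Markman, arXiv:2502.03415 (2025), §9.3 p. 70 L47 (`Φ̃ := Φ ∘ ([Θ ⊠ Θ] ⊗)`), p. 71 L54–70. [Markman2025SecantWeil]
* S. Mukai, Nagoya Math. J. 81 (1981), §1 (1.1), (1.4). [Mukai1981]
* R. Hartshorne, *Algebraic Geometry* (1977), II Ex. 6.8, III Ex. 4.5. [Hartshorne1977]
* The Stacks Project, Tag 01CA (Lemma 17.16.1, 17.16.4), Tag 0B8M. [StacksProject]
-/

noncomputable section

-- `TopCat.Presheaf`/`Scheme.Modules` are not reducible (as in Mathlib's `AlgebraicGeometry/Modules/Sheaf.lean`).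
set_option backward.isDefEq.respectTransparency false

open CategoryTheory CategoryTheory.Limits AlgebraicGeometry MonoidalCategory CartesianMonoidalCategory
open AlgebraicGeometry.Scheme.Modules

universe w₁ w₂ w₃ u

/-! ### §0 Kernel functors: congruence in the kernel and absorption of a source twist -/

namespace Literature.AlgebraicGeometry.Modules

open Literature.AlgebraicGeometry.Motives Literature.AlgebraicGeometry.AbelianVarieties

section KernelTwist

variable {P X : Scheme.{u}} (p : P ⟶ X)

/-- `K ≅ K′ ⟹ (K ⊗ p^*(–)) ≅ (K′ ⊗ p^*(–))` (whiskering the kernel isomorphism). [cite: Mukai1981, §1 (1.1) p. 154] -/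
def integralKernelFunctorIsoOfIso {K K' : P.Modules} (e : K ≅ K') : integralKernelFunctor p K ≅ integralKernelFunctor p K' :=
  Functor.isoWhiskerLeft (Scheme.Modules.pullback p) ((tensorBifunctor P).mapIso e)

/-- **A source twist by a vector bundle is absorbed into the kernel:** `(L ⊗ –) ⋙ (K ⊗ p^*(–)) ≅ ((K ⊗ p^*L) ⊗ p^*(–))`
for `L` finite locally free on `X` (`p^*(L ⊗ M) ≅ p^*L ⊗ p^*M` naturally in `M`, then the associator).
[cite: StacksProject, Tag 01CA (Lemma 17.16.1 and 17.16.4)] [cite: Mukai1981, §1 (1.1) p. 154] -/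
def tensorLeftCompIntegralKernelFunctorIso (K : P.Modules) {L : X.Modules} (hL : IsFiniteLocallyFree L) :
    (tensorBifunctor X).obj L ⋙ integralKernelFunctor p K ≅
      integralKernelFunctor p (tensorObj K ((Scheme.Modules.pullback p).obj L)) :=
  (Functor.associator _ _ _).symm ≪≫ Functor.isoWhiskerRight (pullbackTensorNatIsoOfLeft p hL) _ ≪≫
    Functor.associator _ _ _ ≪≫
    Functor.isoWhiskerLeft (Scheme.Modules.pullback p) (tensorLeftCompIso K ((Scheme.Modules.pullback p).obj L))

end KernelTwist

section TransformTwist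

variable {P X Y : Scheme.{u}} (p : P ⟶ X) (q : P ⟶ Y) {K K' : P.Modules} {L : X.Modules}
  [HasDerivedCategory.{w₁} X.Modules] [HasDerivedCategory.{w₂} P.Modules] [HasDerivedCategory.{w₃} Y.Modules]
  [PreservesFiniteLimits (Scheme.Modules.pullback p)]
  [PreservesFiniteLimits ((tensorBifunctor P).obj K)] [PreservesFiniteColimits ((tensorBifunctor P).obj K)]
  [PreservesFiniteLimits ((tensorBifunctor P).obj K')] [PreservesFiniteColimits ((tensorBifunctor P).obj K')]
  [((tensorBifunctor X).obj L).Additive] [PreservesFiniteLimits ((tensorBifunctor X).obj L)]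
  [PreservesFiniteColimits ((tensorBifunctor X).obj L)]

/-- **`D⁺(L ⊗ –) ⋙ Φ^{p,q}_K ≅ Φ^{p,q}_{K′}` for `K ⊗ p^*L ≅ K′`**: twisting the source by a vector bundle `L` before an
integral transform is the integral transform with the twisted kernel (`D⁺` of `tensorLeftCompIntegralKernelFunctorIso` and of the
kernel congruence; `Rq_*` untouched). Exactness instances are binders. [cite: Mukai1981, §1 (1.1), (1.4)] [cite: StacksProject, Tag 01CA] -/
def integralTransformPlusTwistIso (hL : IsFiniteLocallyFree L) (e : tensorObj K ((Scheme.Modules.pullback p).obj L) ≅ K') :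
    ((tensorBifunctor X).obj L).mapDerivedCategoryPlus ⋙ integralTransformPlus p q K ≅ integralTransformPlus p q K' := by
  haveI := additive_integralKernelFunctor p K
  haveI := preservesFiniteLimits_integralKernelFunctor p K
  haveI := preservesFiniteColimits_integralKernelFunctor p K
  haveI := additive_integralKernelFunctor p K'
  haveI := preservesFiniteLimits_integralKernelFunctor p K'
  haveI := preservesFiniteColimits_integralKernelFunctor p K'
  let Tw := (tensorBifunctor X).obj L
  let G := integralKernelFunctor p K
  let G' := integralKernelFunctor p K'
  change Tw.mapDerivedCategoryPlus ⋙ G.mapDerivedCategoryPlus ⋙ derivedPushforwardPlus q ≅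
    G'.mapDerivedCategoryPlus ⋙ derivedPushforwardPlus q
  exact (Functor.associator _ _ _).symm ≪≫
    Functor.isoWhiskerRight ((Functor.mapDerivedCategoryPlusCompIso Tw G).symm ≪≫
      Functor.mapDerivedCategoryPlusIsoOfIso _ _
        (tensorLeftCompIntegralKernelFunctorIso p K hL ≪≫ integralKernelFunctorIsoOfIso p e)) _

end TransformTwist

end Literature.AlgebraicGeometry.Modules

namespace Literature.AlgebraicGeometry.AbelianVarieties

open Literature.AlgebraicGeometry.Motives Literature.AlgebraicGeometry.Modules

variable (A : AbelianVariety ℂ) {Θ : CartierDivisor A.X.left} (hΘ : Θ.IsAmple)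

/-! ### §1 `Θ ⊠ Θ`, Markman's `Φ̃` as the span transform with kernel `𝒩`, and `Φ̃ ≅ Φ ∘ ([Θ ⊠ Θ] ⊗)` -/

section ThetaBox

/-- `(f ≫ g)^* = f^* ∘ g^*` on `Ȟ¹(–, 𝒪^×)` (the tree's `CechPic.pullback_comp` of `Modules/UnitCocyclePresented`, outside
this file's imports; re-proved privately as in `PoincareSheafOfPrincipal`). [cite: Hartshorne1977, II Ex. 6.8 (functoriality of f^* on Pic)] -/
private theorem cechPic_pullback_comp {X Y Z : Scheme.{0}} (f : X ⟶ Y) (g : Y ⟶ Z) (c : CechPic Z) :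
    CechPic.pullback (f ≫ g) c = CechPic.pullback f (CechPic.pullback g c) := by
  obtain ⟨c, rfl⟩ := CechPic.mk_surjective c
  rw [CechPic.pullback_mk, CechPic.pullback_mk, CechPic.pullback_mk]
  refine CechPic.sound (UnitCocycle.equiv_of_eq _ _
    (fun x => f ⁻¹ᵁ (g ⁻¹ᵁ c.U (g.base (f.base x)))) (fun x => c.mem (g.base (f.base x)))
    (fun x => le_of_eq rfl) (fun x => le_rfl) fun x y V hx hy => ?_)
  change (g.appLE _ _ _ ≫ f.appLE _ V _) (c.g _ _ _ _ _) = (f ≫ g).appLE _ V _ (c.g _ _ _ _ _)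
  rw [Scheme.Hom.appLE_comp_appLE]
  rfl

variable (Θ) in
/-- **`Θ ⊠ Θ := p₁^*𝒪(Θ) ⊗ p₂^*𝒪(Θ)` on `A × A`.** [cite: Markman2025SecantWeil, §9.3 p. 70 L47] -/
def thetaBox : (A.X ⊗ A.X).left.Modules :=
  tensorObj ((Scheme.Modules.pullback (fst A.X A.X).left).obj (lineBundle Θ.toUnitCocycle))
    ((Scheme.Modules.pullback (snd A.X A.X).left).obj (lineBundle Θ.toUnitCocycle))

/-- `Θ ⊠ Θ` is finite locally free. [cite: StacksProject, Tag 01CA] -/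
theorem isFiniteLocallyFree_thetaBox : IsFiniteLocallyFree (thetaBox A Θ) :=
  isFiniteLocallyFree_tensorObj _ _ (Θ.toUnitCocycle.isFiniteLocallyFree_lineBundle.pullback _)
    (Θ.toUnitCocycle.isFiniteLocallyFree_lineBundle.pullback _)

/-- `Θ ⊠ Θ` has rank one. [cite: StacksProject, Tag 01CA] -/
theorem hasRank_thetaBox : HasRank (thetaBox A Θ) 1 :=
  hasRank_tensorObj_one (hasRank_pullback _ Θ.toUnitCocycle.hasRank_lineBundle)
    (hasRank_pullback _ Θ.toUnitCocycle.hasRank_lineBundle)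

/-- `[Θ ⊠ Θ] ⊗ –` is additive. [cite: StacksProject, Tag 01CA] -/
theorem additive_tensor_thetaBox : ((tensorBifunctor (A.X ⊗ A.X).left).obj (thetaBox A Θ)).Additive :=
  additive_tensorBifunctor_obj _

/-- `[Θ ⊠ Θ] ⊗ –` is left exact (a line bundle is invertible). [cite: StacksProject, Tag 0B8M] -/
theorem preservesFiniteLimits_tensor_thetaBox : PreservesFiniteLimits ((tensorBifunctor (A.X ⊗ A.X).left).obj (thetaBox A Θ)) :=
  (isInvertibleModule_of_hasRank_one (isFiniteLocallyFree_thetaBox A (Θ := Θ)) (hasRank_thetaBox A (Θ := Θ))).preservesFiniteLimits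

/-- `[Θ ⊠ Θ] ⊗ –` is right exact. [cite: StacksProject, Tag 0B8M] -/
theorem preservesFiniteColimits_tensor_thetaBox :
    PreservesFiniteColimits ((tensorBifunctor (A.X ⊗ A.X).left).obj (thetaBox A Θ)) :=
  (isInvertibleModule_of_hasRank_one (isFiniteLocallyFree_thetaBox A (Θ := Θ)) (hasRank_thetaBox A (Θ := Θ))).preservesFiniteColimits

/-- **`pr₁₂^*[Θ ⊠ Θ] = a^*[Θ] · b^*[Θ]`** in `Ȟ¹((A × A) × Â, 𝒪^×)` (`a = pr₁₂ ≫ p₁`, `b = pr₁₂ ≫ p₂`). [cite: Hartshorne1977, II Ex. 6.8] -/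
theorem pullback_pr₁₂_detClass_thetaBox :
    CechPic.pullback (pr₁₂ A A (A.dualOf Θ hΘ)).left (detClass (isFiniteLocallyFree_thetaBox A (Θ := Θ))) =
      CechPic.pullback (pr₁₂ A A (A.dualOf Θ hΘ) ≫ fst A.X A.X).left Θ.cechClass *
        CechPic.pullback (pr₁₂ A A (A.dualOf Θ hΘ) ≫ snd A.X A.X).left Θ.cechClass := by
  have hΘ₁ := Θ.toUnitCocycle.isFiniteLocallyFree_lineBundle
  have hΘr := Θ.toUnitCocycle.hasRank_lineBundle
  have step1 := detClass_tensorObj_of_hasRank_one (hasRank_pullback (fst A.X A.X).left hΘr)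
    (hasRank_pullback (snd A.X A.X).left hΘr) (hΘ₁.pullback (fst A.X A.X).left) (hΘ₁.pullback (snd A.X A.X).left)
    (isFiniteLocallyFree_thetaBox A (Θ := Θ))
  have step2 := detClass_pullback (fst A.X A.X).left hΘ₁
  have step3 := detClass_pullback (snd A.X A.X).left hΘ₁
  rw [step1, MonoidHom.map_mul, step2, step3, detClass_lineBundle_toUnitCocycle, Over.comp_left, Over.comp_left,
    cechPic_pullback_comp, cechPic_pullback_comp]

end ThetaBox

section PhiTilde

variable (hK : A.KTheta Θ = ⊥)

/-- `𝒩 ⊗ –` is left exact (the twisted span kernel is a line bundle). [cite: StacksProject, Tag 0B8M] -/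
theorem preservesFiniteLimits_tensor_markmanTwistedKernel :
    PreservesFiniteLimits ((tensorBifunctor ((A.X ⊗ A.X) ⊗ (A.dualOf Θ hΘ).X).left).obj (markmanTwistedKernel A hΘ hK)) :=
  (isInvertibleModule_of_hasRank_one (isFiniteLocallyFree_markmanTwistedKernel A hΘ hK)
    (hasRank_markmanTwistedKernel A hΘ hK)).preservesFiniteLimits

/-- `𝒩 ⊗ –` is right exact. [cite: StacksProject, Tag 0B8M] -/
theorem preservesFiniteColimits_tensor_markmanTwistedKernel :
    PreservesFiniteColimits ((tensorBifunctor ((A.X ⊗ A.X) ⊗ (A.dualOf Θ hΘ).X).left).obj (markmanTwistedKernel A hΘ hK)) :=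
  (isInvertibleModule_of_hasRank_one (isFiniteLocallyFree_markmanTwistedKernel A hΘ hK)
    (hasRank_markmanTwistedKernel A hΘ hK)).preservesFiniteColimits

/-- **`𝒩₁ ⊗ pr₁₂^*(Θ ⊠ Θ) ≅ 𝒩`** — the twisted kernel IS the span kernel twisted by the pulled-back `Θ ⊠ Θ` (both rank one with
the same class, `detClass_markmanTwistedKernel`). [cite: Markman2025SecantWeil, §9.3 p. 70 L47 and p. 71 L54–70] [cite: Hartshorne1977, III Ex. 4.5] -/
theorem nonempty_markmanSpanKernel_tensor_thetaBox_iso :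
    Nonempty (tensorObj (markmanSpanKernel A hΘ hK) ((Scheme.Modules.pullback (pr₁₂ A A (A.dualOf Θ hΘ)).left).obj (thetaBox A Θ)) ≅
      markmanTwistedKernel A hΘ hK) := by
  have hN := isFiniteLocallyFree_markmanSpanKernel A hΘ hK
  have hN₁ := hasRank_markmanSpanKernel A hΘ hK
  have hB := isFiniteLocallyFree_thetaBox A (Θ := Θ)
  have hB₁ := hasRank_thetaBox A (Θ := Θ)
  refine (nonempty_iso_iff_detClass_eq (hasRank_tensorObj_one hN₁ (hasRank_pullback (pr₁₂ A A (A.dualOf Θ hΘ)).left hB₁))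
    (hasRank_markmanTwistedKernel A hΘ hK) (isFiniteLocallyFree_tensorObj _ _ hN (hB.pullback (pr₁₂ A A (A.dualOf Θ hΘ)).left))
    (isFiniteLocallyFree_markmanTwistedKernel A hΘ hK)).2 ?_
  have e₁ := detClass_tensorObj_of_hasRank_one hN₁ (hasRank_pullback (pr₁₂ A A (A.dualOf Θ hΘ)).left hB₁) hN
    (hB.pullback (pr₁₂ A A (A.dualOf Θ hΘ)).left)
    (isFiniteLocallyFree_tensorObj _ _ hN (hB.pullback (pr₁₂ A A (A.dualOf Θ hΘ)).left))
  have e₂ := detClass_pullback (pr₁₂ A A (A.dualOf Θ hΘ)).left hB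
  rw [e₁, e₂, pullback_pr₁₂_detClass_thetaBox, detClass_markmanTwistedKernel, mul_assoc]

/-- A chosen isomorphism `𝒩₁ ⊗ pr₁₂^*(Θ ⊠ Θ) ≅ 𝒩`. [cite: Markman2025SecantWeil, §9.3 p. 70 L47] -/
def markmanSpanKernelTensorThetaBoxIso :
    tensorObj (markmanSpanKernel A hΘ hK) ((Scheme.Modules.pullback (pr₁₂ A A (A.dualOf Θ hΘ)).left).obj (thetaBox A Θ)) ≅
      markmanTwistedKernel A hΘ hK :=
  (nonempty_markmanSpanKernel_tensor_thetaBox_iso A hΘ hK).some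

variable [HasDerivedCategory.{w₁} (A.X ⊗ A.X).left.Modules]
  [HasDerivedCategory.{w₂} ((A.X ⊗ A.X) ⊗ (A.dualOf Θ hΘ).X).left.Modules]
  [HasDerivedCategory.{w₃} (A.X ⊗ (A.dualOf Θ hΘ).X).left.Modules]

/-- **MARKMAN'S TWISTED TRANSFORM `Φ̃ : D⁺(Mod 𝒪_{A×A}) ⥤ D⁺(Mod 𝒪_{A×Â})` as the span transform with the twisted kernel,
`Φ̃(E•) = Rg′_*(𝒩 ⊗ pr₁₂^*E•)`** along `A × A ⟵pr₁₂— (A × A) × Â —g′⟶ A × Â` (`𝒩 = 𝒩₁ ⊗ a^*𝒪(Θ) ⊗ b^*𝒪(Θ)`); it is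
`Φ ∘ ([Θ ⊠ Θ] ⊗)` by `markmanPhiTildePlusIso`. [cite: Markman2025SecantWeil, §9.3 p. 70 L47] [cite: Mukai1981, §1 (1.4)] -/
def markmanPhiTildePlus :
    DerivedCategory.Plus (A.X ⊗ A.X).left.Modules ⥤ DerivedCategory.Plus (A.X ⊗ (A.dualOf Θ hΘ).X).left.Modules :=
  haveI := preservesFiniteLimits_pullback_pr₁₂ A A (A.dualOf Θ hΘ)
  haveI := preservesFiniteLimits_tensor_markmanTwistedKernel A hΘ hK
  haveI := preservesFiniteColimits_tensor_markmanTwistedKernel A hΘ hK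
  integralTransformPlus (pr₁₂ A A (A.dualOf Θ hΘ)).left (kernelSpanMap A hΘ).left (markmanTwistedKernel A hΘ hK)

/-- **`Φ̃ ≅ Φ ∘ ([Θ ⊠ Θ] ⊗)`: `D⁺([Θ ⊠ Θ] ⊗ –) ⋙ markmanPhiPlus ≅ markmanPhiTildePlus`** — print's definition of `Φ̃` recovered
for the tree's `Φ` (`markmanPhiPlusSpanIso`: `Φ ≅ Φ^{pr₁₂, g′}_{𝒩₁}`; then the source twist `Θ ⊠ Θ` is absorbed into the kernel,
`𝒩₁ ⊗ pr₁₂^*(Θ ⊠ Θ) ≅ 𝒩`). Exactness instances of `[Θ ⊠ Θ] ⊗ –` are binders (`additive_/preservesFinite(Co)Limits_tensor_thetaBox`).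
[cite: Markman2025SecantWeil, §9.3 p. 70 L47] [cite: Mukai1981, §1 (1.1), (1.4)] -/
def markmanPhiTildePlusIso [((tensorBifunctor (A.X ⊗ A.X).left).obj (thetaBox A Θ)).Additive]
    [PreservesFiniteLimits ((tensorBifunctor (A.X ⊗ A.X).left).obj (thetaBox A Θ))]
    [PreservesFiniteColimits ((tensorBifunctor (A.X ⊗ A.X).left).obj (thetaBox A Θ))] :
    ((tensorBifunctor (A.X ⊗ A.X).left).obj (thetaBox A Θ)).mapDerivedCategoryPlus ⋙ markmanPhiPlus A hΘ hK ≅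
      markmanPhiTildePlus A hΘ hK := by
  haveI := preservesFiniteLimits_pullback_pr₁₂ A A (A.dualOf Θ hΘ)
  haveI := preservesFiniteLimits_tensor_markmanSpanKernel A hΘ hK
  haveI := preservesFiniteColimits_tensor_markmanSpanKernel A hΘ hK
  haveI := preservesFiniteLimits_tensor_markmanTwistedKernel A hΘ hK
  haveI := preservesFiniteColimits_tensor_markmanTwistedKernel A hΘ hK
  exact Functor.isoWhiskerLeft _ (markmanPhiPlusSpanIso A hΘ hK) ≪≫
    integralTransformPlusTwistIso (pr₁₂ A A (A.dualOf Θ hΘ)).left (kernelSpanMap A hΘ).left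
      (isFiniteLocallyFree_thetaBox A (Θ := Θ)) (markmanSpanKernelTensorThetaBoxIso A hΘ hK)

/-- Objectwise form (instances discharged): `Φ([Θ ⊠ Θ] ⊗ E) ≅ Φ̃(E)` in `D⁺(Mod 𝒪_{A×Â})`. [cite: Markman2025SecantWeil, §9.3 p. 70 L47] -/
theorem nonempty_markmanPhiPlus_thetaBox_iso (E : DerivedCategory.Plus (A.X ⊗ A.X).left.Modules) :
    Nonempty ((markmanPhiPlus A hΘ hK).obj
        ((haveI := additive_tensor_thetaBox A (Θ := Θ)
          haveI := preservesFiniteLimits_tensor_thetaBox A (Θ := Θ)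
          haveI := preservesFiniteColimits_tensor_thetaBox A (Θ := Θ)
          ((tensorBifunctor (A.X ⊗ A.X).left).obj (thetaBox A Θ)).mapDerivedCategoryPlus).obj E) ≅
      (markmanPhiTildePlus A hΘ hK).obj E) :=
  haveI := additive_tensor_thetaBox A (Θ := Θ)
  haveI := preservesFiniteLimits_tensor_thetaBox A (Θ := Θ)
  haveI := preservesFiniteColimits_tensor_thetaBox A (Θ := Θ)
  ⟨(markmanPhiTildePlusIso A hΘ hK).app E⟩

end PhiTilde

end Literature.AlgebraicGeometry.AbelianVarieties

end
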